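import Summits.QuantumFields.YangMills.Theorems.UnitScaleTiltProp7BoxChartTransport
import Summits.QuantumFields.YangMills.Theorems.UnitScaleTiltProp7LatticeBoxLocalPotential
import HarnessLib

/-!
# Route `UnitScaleTilt`, crux K1 «MinimiserStabilityRegPr» (stmt-QuantumFields-19200), LANE II «DIVERGENCE RECOVERY AT CURVED `W`» (★★OWNER RULING №23),
# brick (B8-member) = ★p1 g19 NAMER WORD №13 [I-4]: THE LOCAL COULOMB POTENTIAL OF A BOX PATCH, READ AT THE MEMBER THROUGH THE BOX CHART

Cell `ym3-torus`, width seat `ym3-torus-px12` (gen 7).  THEOREMS ONLY (0 `def`, 0 `sorry`); `--supports stmt-QuantumFields-19200 --as helper`, count-neutral.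
YM₃ on T³ is a ladder rung (R3), not d = 4, not the Clay problem; nothing here claims a stub, the crux or the gap.

THE POINT.  px4 g7's ✓`Prop7LatticeBoxLocalPotential.boxLocalPotential_trace` solves, on a `ℤᵈ` box `Q_R(z)` with a unitary connection `V` of small plaquettes, the constrained
least-squares problem `y_Z = ∇_Vφ_Z + r_Z`, patch-`div_V r_Z = R(u)⁻¹m` (an axial-constant source), with Pythagoras, the source bound and the box Poincaré inequality.  This file
reads it AT THE MEMBER of record (`F : T3Family`, fine torus `Site (F.P K) 0`, `ℓ = L^{K−n}`, `η = eta F n K = ℓ⁻¹`, weight `c₀`) through the injective box chart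
`w ↦ transl c w` of ✓`Prop7BoxChartTransport` (`2R + 1 ≤ N`): for a background `W`, its pull-back `V w μ = W♮⟨transl c w, μ⟩`, and a one-form `y : BondL2K`, there are
member fields `φ κs : SiteL2K`, `r : BondL2K` — `φ = toL2S (η • push φ_Z)`, `r = toL2 (push (1_{inside}·r_Z))`, `κs = D*_W y − Δ_W φ` — with
(S) the chart readings and supports; (D) `D_Wφ = ∇_Vφ_Z` on the inside chart bonds (so (B7-MEMBER-CORE)'s `hDφ` holds for every bond cutoff living on inside bonds);
(hloc) `D*_W y = Δ_W φ + κs` EXACTLY; (L1) on the interior `Q_{R−1}` the source is `κs = η⁻¹·R(u)⁻¹m`; (h1) PYTHAGORAS `N_in(y) = G(φ) + ‖r‖²`;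
(h2) POINCARÉ `‖φ‖² ≤ 16·R(2R+1)·η²·G(φ)`; (h3) SOURCE `c₀·Σ_{Q_{R−1}}‖η⁻¹R(u)⁻¹m‖_F² ≤ 16d³·2·R²α²·η⁻²·‖r‖²` — all in the member's Frobenius currency
(`N_in(y) := c₀·Σ_{inside bonds}‖y‖_F²`, `G(φ) := c₀·Σ_{inside bonds}‖∇_Vφ_Z‖_F²`).
HONEST SCOPE.  Bookkeeping over ✓(B8) and ✓(T-box); the plaquette hypotheses `hP`∕`hw` stay DISPLAYED on the pull-back `V` (their discharge from `RegPr` is the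
member geometry file's); nothing of (REC)∕hN06∕the crux is proved here.

References: T. Bałaban, CMP 99 (1985) 389–434 [Balaban1985BackgroundPropagators] ((3.3), (3.8), (3.11) pp.391–392, (3.23) p.394, (3.100) p.413); CMP 99 (1985) 75–102
[Balaban1985RegularSpaces] ((1.1)–(1.2) p.76); M. Giaquinta, *Multiple integrals …* (1983) [Giaquinta1984] (Ch. III §1–§2).
-/

set_option autoImplicit false

noncomputable section

open scoped BigOperators Matrix.Norms.L2Operator InnerProductSpace
open Finset

namespace Summit.QuantumFields.YangMills.Theorems.Prop7BoxLocalPotentialMember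

open Literature.MathematicalPhysics.QuantumFieldTheory.Balaban1983to89
open Literature.MathematicalPhysics.QuantumFieldTheory.Balaban1983to89.T3ContinuumYM3Torus
open Literature.MathematicalPhysics.QuantumFieldTheory.Balaban1983to89.B4Eq19LatticeOperators (Zd box mem_box unitVec box_mono add_unitVec_mem_box sub_unitVec_mem_box)
open B10Eq27TorusAxialLog (transl unitsField toUField unitsField_mem_unitaryUnits)
open B9TorusCalculus (torusT)
open B9Eq39Adjoint (divB)
open B7Eq78Linearization (conjR conjR_apply)
open B7Prop1Explicit (axialFn)
open B7Prop2Explicit (unitaryUnits)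
open T3SectALandauChart (eta eta_pos covDerivFwdT covDivFormT bgUnits)
open B11Eq103H1Complex (SiteL2K BondL2K)
open Summit.QuantumFields.YangMills.Theorems.Prop7SectET3Transport (periodsT3)
open Summit.QuantumFields.YangMills.Theorems.Prop7SectET3HilbertLetters (W₂ frobEquiv toL2 toL2S DL2 DstarL2 covLapSite)
open Summit.QuantumFields.YangMills.Theorems.Prop7LandauDict (DL2_toL2S_eq_covDerivFwdT DstarL2_toL2_eq_covDivFormT)
open Summit.QuantumFields.YangMills.Theorems.Prop7DivSliceOfMemberDivSq (covDivFormT_eta_eq_smul_divB inv_eta_sq_eq)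
open Summit.QuantumFields.YangMills.Theorems.Prop7RieszTauFrobNorm (norm_sq_frobEquiv_symm sum_norm_sq_le_two_mul_opNorm_sq)
open Summit.QuantumFields.YangMills.Theorems.Prop7LatticeBoxPotentialAlgebra (re_trace_conjR_conjR)
open Summit.QuantumFields.YangMills.Theorems.Prop7LatticeBoxLocalPotential (boxLocalPotential_trace)
open Summit.QuantumFields.YangMills.Theorems.PoincareLipschitzCovariantBridge (transl_add_unitVec transl_sub_unitVec)
open Summit.QuantumFields.YangMills.Theorems.Prop7BoxChartTransport

variable (F : T3Family) (n K : ℕ) (c₀ : ℝ) [Fact (0 < c₀)]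

/-! ## §1 Member letters at chart points -/

/-- `R(U)(t•M) = t•R(U)M` for a real scalar. [folklore] -/
theorem conjR_real_smul (U : (Matrix (Fin 2) (Fin 2) ℂ)ˣ) (t : ℝ) (M : Matrix (Fin 2) (Fin 2) ℂ) : conjR U (t • M) = t • conjR U M := by
  rw [conjR_apply, conjR_apply, Matrix.mul_smul, Matrix.smul_mul]

/-- **`D_W (toL2S (η•Φ))` ON A BOND IS THE UNIT-LATTICE COVARIANT DIFFERENCE OF `Φ`**: `(toL2)⁻¹(D_W(toL2S(η•Φ)))(b) = R(W♮ b)Φ(b₊) − Φ(b₋)`.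
[cite: Balaban1985BackgroundPropagators, (3.3) p.391; Balaban1985RegularSpaces, (1.1) p.76] -/
theorem DL2_toL2S_eta_smul_apply (W : GaugeField (F.P K) 0 (Matrix.specialUnitaryGroup (Fin 2) ℂ)) (Φ : Site (F.P K) 0 → Matrix (Fin 2) (Fin 2) ℂ)
    (b : PBond (F.P K) 0) :
    (toL2 F K c₀).symm (DL2 F n K c₀ W (toL2S F K c₀ ((eta F n K) • Φ))) b
      = conjR (unitsField (toUField W) b) (Φ (b.src.shift b.dir)) - Φ b.src := by
  have hη : eta F n K ≠ 0 := (eta_pos F n K).ne'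
  rw [DL2_toL2S_eq_covDerivFwdT, covDerivFwdT, Pi.smul_apply, Pi.smul_apply, conjR_real_smul, ← smul_sub, smul_smul, inv_mul_cancel₀ hη, one_smul]
  rfl

/-- **`D*_W (toL2 X)` AT A CHART SITE IN px4's `ℤᵈ` LETTERS**: `(toL2S)⁻¹(D*_W(toL2 X))(transl c w) = η⁻¹ • Σ_μ (R(W♮⟨transl c (w−e_μ), μ⟩)⁻¹ X⟨transl c (w−e_μ), μ⟩ − X⟨transl c w, μ⟩)`.
[cite: Balaban1985BackgroundPropagators, (3.8) p.392; Balaban1985RegularSpaces, (1.2) p.76] -/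
theorem DstarL2_toL2_apply_transl (W : GaugeField (F.P K) 0 (Matrix.specialUnitaryGroup (Fin 2) ℂ)) (X : PBond (F.P K) 0 → Matrix (Fin 2) (Fin 2) ℂ)
    (c : Site (F.P K) 0) (w : Zd (F.P K).d) :
    (toL2S F K c₀).symm (DstarL2 F n K c₀ W (toL2 F K c₀ X)) (transl c w)
      = (eta F n K)⁻¹ • ∑ μ, (conjR (unitsField (toUField W) ⟨transl c (w - unitVec μ), μ⟩)⁻¹ (X ⟨transl c (w - unitVec μ), μ⟩) - X ⟨transl c w, μ⟩) := by
  rw [DstarL2_toL2_eq_covDivFormT, covDivFormT_eta_eq_smul_divB, divB_transl]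

/-- `Σ_jk ‖(t•M) j k‖² = t²·Σ_jk ‖M j k‖²` for a real scalar. [folklore] -/
theorem sum_norm_sq_real_smul (t : ℝ) (M : Matrix (Fin 2) (Fin 2) ℂ) :
    ∑ j : Fin 2, ∑ k : Fin 2, ‖(t • M) j k‖ ^ 2 = t ^ 2 * ∑ j : Fin 2, ∑ k : Fin 2, ‖M j k‖ ^ 2 := by
  rw [Finset.mul_sum]
  refine Finset.sum_congr rfl fun j _ => ?_
  rw [Finset.mul_sum]
  refine Finset.sum_congr rfl fun k _ => ?_
  rw [Matrix.smul_apply, norm_smul, mul_pow, Real.norm_eq_abs, sq_abs]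

/-! ## §2 (B8-member): the local Coulomb potential of a box patch at the member -/

/-- ★★★ **(B8-member) — THE LOCAL COULOMB POTENTIAL OF A BOX PATCH, READ AT THE MEMBER** (★p1 g19 NAMER WORD №13 [I-4]).  For the member `F` at heights `n, K`
(`η = eta F n K`), a background `W`, a centre `c` and a box `Q_R(z)` charted injectively (`2R + 1 ≤ N`), the pull-back connection `V w μ = W♮⟨transl c w, μ⟩` with
✓(B8)'s plaquette data `hP`∕`hw` DISPLAYED, and a one-form `y`: there are `φ κs : SiteL2K`, `r : BondL2K`, the box potential `φ_Z` and the source matrix `m` with —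
(S) `φ = η•φ_Z` along the chart and `0` off it; `r = 1_{inside}·(y − ∇_Vφ_Z)` along the chart bonds and `0` off them; (D) `(toL2)⁻¹(D_Wφ) = ∇_Vφ_Z` on the inside chart
bonds; (hloc) `D*_W y = Δ_W φ + κs`; (L1) `(toL2S)⁻¹κs = η⁻¹·R(u)⁻¹m` on the chart of `Q_{R−1}(z)` (`u` = the box axial gauge of `V`); (h1) PYTHAGORAS
`c₀Σ_{inside}‖y‖_F² = c₀Σ_{inside}‖∇_Vφ_Z‖_F² + ‖r‖²`; (h2) POINCARÉ `‖φ‖² ≤ 16R(2R+1)η²·c₀Σ_{inside}‖∇_Vφ_Z‖_F²`; (h3) SOURCE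
`c₀Σ_{w ∈ Q_{R−1}}‖η⁻¹R(u w)⁻¹m‖_F² ≤ 16d³·2·R²α²·η⁻²·‖r‖²`.
[cite: Balaban1985BackgroundPropagators, (3.23) p.394, (3.100) p.413; Balaban1985RegularSpaces, (1.1)-(1.2) p.76; Giaquinta1984, Ch. III §2] -/
theorem boxLocalPotential_member (W : GaugeField (F.P K) 0 (Matrix.specialUnitaryGroup (Fin 2) ℂ))
    (c : Site (F.P K) 0) {z : Zd (F.P K).d} {R : ℤ} (hR : 0 ≤ R) (hRN : 2 * R + 1 ≤ ((F.P K).sitesPerDir 0 : ℤ))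
    (V : Zd (F.P K).d → Fin (F.P K).d → (Matrix (Fin 2) (Fin 2) ℂ)ˣ) (hV : ∀ w μ, V w μ = unitsField (toUField W) ⟨transl c w, μ⟩)
    {α : ℝ} (hα : 0 ≤ α) (hP : B8Lemma1NonAbelian.PlaqSmall V (fun i => z i - R) (fun i => z i + R) α)
    (hw : 64 * ((F.P K).d : ℝ) ^ 3 * 2 * R ^ 3 * (2 * R + 1) * α ^ 2 ≤ 1)
    (y : BondL2K ℂ 3 (periodsT3 F K) c₀ W₂) :
    ∃ (φ κs : SiteL2K ℂ 3 (periodsT3 F K) c₀ W₂) (r : BondL2K ℂ 3 (periodsT3 F K) c₀ W₂)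
      (φZ : Zd (F.P K).d → Matrix (Fin 2) (Fin 2) ℂ) (m : Matrix (Fin 2) (Fin 2) ℂ),
      (∀ x, (∀ w ∈ box z R, transl c w ≠ x) → (toL2S F K c₀).symm φ x = 0) ∧
      (∀ w ∈ box z R, (toL2S F K c₀).symm φ (transl c w) = (eta F n K) • φZ w) ∧
      (∀ b : PBond (F.P K) 0, (∀ w ∈ box z R, transl c w ≠ b.src) → (toL2 F K c₀).symm r b = 0) ∧
      (∀ w ∈ box z R, ∀ μ, (toL2 F K c₀).symm r ⟨transl c w, μ⟩
          = if w + unitVec μ ∈ box z R then (toL2 F K c₀).symm y ⟨transl c w, μ⟩ - (conjR (V w μ) (φZ (w + unitVec μ)) - φZ w) else 0) ∧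
      (∀ w ∈ box z R, ∀ μ, w + unitVec μ ∈ box z R →
          (toL2 F K c₀).symm (DL2 F n K c₀ W φ) ⟨transl c w, μ⟩ = conjR (V w μ) (φZ (w + unitVec μ)) - φZ w) ∧
      (DstarL2 F n K c₀ W y = covLapSite F n K c₀ W φ + κs) ∧
      (∀ w ∈ box z (R - 1), (toL2S F K c₀).symm κs (transl c w) = (eta F n K)⁻¹ • conjR (axialFn V (fun i => z i - R) w)⁻¹ m) ∧
      (c₀ * ∑ w ∈ box z R, ∑ μ, (if w + unitVec μ ∈ box z R then ∑ j : Fin 2, ∑ k : Fin 2, ‖((toL2 F K c₀).symm y ⟨transl c w, μ⟩) j k‖ ^ 2 else 0)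
        = c₀ * ∑ w ∈ box z R, ∑ μ, (if w + unitVec μ ∈ box z R then
              ∑ j : Fin 2, ∑ k : Fin 2, ‖(conjR (V w μ) (φZ (w + unitVec μ)) - φZ w) j k‖ ^ 2 else 0)
          + ‖r‖ ^ 2) ∧
      (‖φ‖ ^ 2 ≤ 16 * R * (2 * R + 1) * (eta F n K) ^ 2 *
          (c₀ * ∑ w ∈ box z R, ∑ μ, (if w + unitVec μ ∈ box z R then
              ∑ j : Fin 2, ∑ k : Fin 2, ‖(conjR (V w μ) (φZ (w + unitVec μ)) - φZ w) j k‖ ^ 2 else 0))) ∧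
      (c₀ * ∑ w ∈ box z (R - 1), ∑ j : Fin 2, ∑ k : Fin 2, ‖((eta F n K)⁻¹ • conjR (axialFn V (fun i => z i - R) w)⁻¹ m) j k‖ ^ 2
        ≤ 16 * ((F.P K).d : ℝ) ^ 3 * 2 * R ^ 2 * α ^ 2 * ((eta F n K)⁻¹) ^ 2 * ‖r‖ ^ 2) := by
  classical
  have hη : 0 < eta F n K := eta_pos F n K
  have hc₀ : 0 < c₀ := Fact.out
  -- the pull-back connection is unitary
  have hVu : ∀ w μ, V w μ ∈ unitaryUnits (Matrix (Fin 2) (Fin 2) ℂ) := fun w μ => by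
    rw [hV]; exact unitsField_mem_unitaryUnits (toUField W) _
  have hu : ∀ w, axialFn V (fun i => z i - R) w ∈ unitaryUnits (Matrix (Fin 2) (Fin 2) ℂ) := fun w => B7Prop2Explicit.hol_mem_of hVu _ _
  -- the one-form read as a bond field, and (B8) on the box for its pull-back
  have hyY : y = toL2 F K c₀ ((toL2 F K c₀).symm y) := (LinearEquiv.apply_symm_apply _ _).symm
  have hw' : 64 * ((F.P K).d : ℝ) ^ 3 * (2 : ℕ) * R ^ 3 * (2 * R + 1) * α ^ 2 ≤ 1 := by push_cast; exact hw
  obtain ⟨φZ, m, -, hPyth, hEL, hSrc, hPoinc⟩ := boxLocalPotential_trace hR hα V hVu hP hw' (fun w μ => (toL2 F K c₀).symm y ⟨transl c w, μ⟩)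
  -- push-forwards along the chart
  obtain ⟨Φs, hΦs, hΦs0⟩ := exists_site_pushforward c hRN φZ
  obtain ⟨Xr, hXr, hXr0⟩ := exists_bond_pushforward c hRN
    (fun w μ => if w + unitVec μ ∈ box z R then (toL2 F K c₀).symm y ⟨transl c w, μ⟩ - (conjR (V w μ) (φZ (w + unitVec μ)) - φZ w) else 0)
  -- (D): the gradient of `φ := toL2S (η • Φs)` on the inside chart bonds
  have hD : ∀ w ∈ box z R, ∀ μ, w + unitVec μ ∈ box z R →
      (toL2 F K c₀).symm (DL2 F n K c₀ W (toL2S F K c₀ ((eta F n K) • Φs))) ⟨transl c w, μ⟩ = conjR (V w μ) (φZ (w + unitVec μ)) - φZ w := by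
    intro w hw μ hwμ
    rw [DL2_toL2S_eta_smul_apply]
    show conjR (unitsField (toUField W) ⟨transl c w, μ⟩) (Φs ((transl c w).shift μ)) - Φs (transl c w) = _
    rw [← transl_add_unitVec, hΦs _ hwμ, hΦs w hw, hV]
  -- the norm of `r := toL2 Xr`
  have hr : ‖toL2 F K c₀ Xr‖ ^ 2 = c₀ * ∑ w ∈ box z R, ∑ μ, (if w + unitVec μ ∈ box z R then
      ∑ j : Fin 2, ∑ k : Fin 2, ‖((toL2 F K c₀).symm y ⟨transl c w, μ⟩ - (conjR (V w μ) (φZ (w + unitVec μ)) - φZ w)) j k‖ ^ 2 else 0) := by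
    rw [norm_toL2_sq_eq_sum_box F K c₀ c hRN Xr hXr0]
    refine congrArg (fun t : ℝ => c₀ * t) (Finset.sum_congr rfl fun w hw => Finset.sum_congr rfl fun μ _ => ?_)
    rw [hXr w hw μ]
    split_ifs with hif
    · rfl
    · simp
  refine ⟨toL2S F K c₀ ((eta F n K) • Φs),
    DstarL2 F n K c₀ W y - covLapSite F n K c₀ W (toL2S F K c₀ ((eta F n K) • Φs)),
    toL2 F K c₀ Xr, φZ, m, ?_, ?_, ?_, ?_, hD, ?_, ?_, ?_, ?_, ?_⟩
  -- (S1a)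
  · intro x hx
    rw [LinearEquiv.symm_apply_apply, Pi.smul_apply, hΦs0 x hx, smul_zero]
  -- (S1b)
  · intro w hw
    rw [LinearEquiv.symm_apply_apply, Pi.smul_apply, hΦs w hw]
  -- (S2a)
  · intro b hb
    rw [LinearEquiv.symm_apply_apply]
    exact hXr0 b hb
  -- (S2b)
  · intro w hw μ
    rw [LinearEquiv.symm_apply_apply]
    exact hXr w hw μ
  -- (hloc)
  · abel
  -- (L1)
  · intro w hw1
    have hwR : w ∈ box z R := box_mono z (by linarith) hw1
    have hwm : ∀ μ, w - unitVec μ ∈ box z R := fun μ => by simpa using sub_unitVec_mem_box hw1 μ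
    have hwp : ∀ μ, w + unitVec μ ∈ box z R := fun μ => by simpa using add_unitVec_mem_box hw1 μ
    -- `κs = D*_W (y − D_Wφ)` read at the chart site
    have hG : DL2 F n K c₀ W (toL2S F K c₀ ((eta F n K) • Φs))
        = toL2 F K c₀ ((toL2 F K c₀).symm (DL2 F n K c₀ W (toL2S F K c₀ ((eta F n K) • Φs)))) := by
      rw [LinearEquiv.apply_symm_apply]
    have hΔ : covLapSite F n K c₀ W (toL2S F K c₀ ((eta F n K) • Φs))
        = DstarL2 F n K c₀ W (DL2 F n K c₀ W (toL2S F K c₀ ((eta F n K) • Φs))) := rfl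
    rw [hΔ, ← LinearMap.map_sub, hG]
    conv_lhs => rw [hyY]
    rw [← map_sub, DstarL2_toL2_apply_transl]
    refine congrArg (fun M : Matrix (Fin 2) (Fin 2) ℂ => (eta F n K)⁻¹ • M) ?_
    rw [← hEL w hwR]
    refine Finset.sum_congr rfl fun μ _ => ?_
    rw [if_pos (hwm μ), if_pos (hwp μ)]
    try simp only [Pi.sub_apply]
    rw [hD (w - unitVec μ) (hwm μ) μ (by rw [sub_add_cancel]; exact hwR), hD w hwR μ (hwp μ), sub_add_cancel, ← hV]
  -- (h1) Pythagoras
  · have hP' := hPyth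
    simp_rw [← MatrixNorms.sum_norm_sq_eq_re_trace] at hP'
    rw [hr, ← mul_add, hP']
  -- (h2) Poincaré
  · have hφn : ‖toL2S F K c₀ ((eta F n K) • Φs)‖ ^ 2 = c₀ * ∑ w ∈ box z R, ∑ j : Fin 2, ∑ k : Fin 2, ‖((eta F n K) • φZ w) j k‖ ^ 2 := by
      rw [norm_sq_toL2S_eq_sum_box F K c₀ c hRN ((eta F n K) • Φs) (fun x hx => by rw [Pi.smul_apply, hΦs0 x hx, smul_zero])]
      exact congrArg (fun t : ℝ => c₀ * t) (Finset.sum_congr rfl fun w hw => by rw [Pi.smul_apply, hΦs w hw])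
    rw [hφn]
    simp_rw [sum_norm_sq_real_smul]
    have hPo : ∑ x ∈ box z R, ‖φZ x‖ ^ 2 ≤ 4 * 2 * R * (2 * R + 1) *
        ∑ x ∈ box z R, ∑ μ, (if x + unitVec μ ∈ box z R then ‖conjR (V x μ) (φZ (x + unitVec μ)) - φZ x‖ ^ 2 else 0) := by
      have h := hPoinc; push_cast at h; exact h
    have hOF : ∑ x ∈ box z R, ∑ μ, (if x + unitVec μ ∈ box z R then ‖conjR (V x μ) (φZ (x + unitVec μ)) - φZ x‖ ^ 2 else 0)
        ≤ ∑ x ∈ box z R, ∑ μ, (if x + unitVec μ ∈ box z R then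
            ∑ j : Fin 2, ∑ k : Fin 2, ‖(conjR (V x μ) (φZ (x + unitVec μ)) - φZ x) j k‖ ^ 2 else 0) := by
      refine Finset.sum_le_sum fun x _ => Finset.sum_le_sum fun μ _ => ?_
      split_ifs
      · exact MatrixNorms.opNorm_sq_le_sum_norm_sq _
      · exact le_rfl
    have hR0 : (0 : ℝ) ≤ R := by exact_mod_cast hR
    calc c₀ * ∑ w ∈ box z R, (eta F n K) ^ 2 * ∑ j : Fin 2, ∑ k : Fin 2, ‖φZ w j k‖ ^ 2
        ≤ c₀ * ∑ w ∈ box z R, (eta F n K) ^ 2 * (2 * ‖φZ w‖ ^ 2) := by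
          refine mul_le_mul_of_nonneg_left (Finset.sum_le_sum fun w _ => ?_) hc₀.le
          exact mul_le_mul_of_nonneg_left (sum_norm_sq_le_two_mul_opNorm_sq _) (sq_nonneg _)
      _ = 2 * (eta F n K) ^ 2 * c₀ * ∑ w ∈ box z R, ‖φZ w‖ ^ 2 := by
          rw [← Finset.mul_sum, ← Finset.mul_sum]; ring
      _ ≤ 2 * (eta F n K) ^ 2 * c₀ * (4 * 2 * R * (2 * R + 1) *
            ∑ x ∈ box z R, ∑ μ, (if x + unitVec μ ∈ box z R then
              ∑ j : Fin 2, ∑ k : Fin 2, ‖(conjR (V x μ) (φZ (x + unitVec μ)) - φZ x) j k‖ ^ 2 else 0)) := by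
          refine mul_le_mul_of_nonneg_left (hPo.trans ?_) (by positivity)
          exact mul_le_mul_of_nonneg_left hOF (by positivity)
      _ = _ := by ring
  -- (h3) the source
  · have hinv : ∀ w, ∑ j : Fin 2, ∑ k : Fin 2, ‖(((eta F n K)⁻¹ • conjR (axialFn V (fun i => z i - R) w)⁻¹ m)) j k‖ ^ 2
        = ((eta F n K)⁻¹) ^ 2 * ∑ j : Fin 2, ∑ k : Fin 2, ‖m j k‖ ^ 2 := by
      intro w
      rw [sum_norm_sq_real_smul, MatrixNorms.sum_norm_sq_eq_re_trace, MatrixNorms.sum_norm_sq_eq_re_trace,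
        re_trace_conjR_conjR ((unitaryUnits _).inv_mem (hu w))]
    simp_rw [hinv]
    rw [Finset.sum_const, nsmul_eq_mul]
    have hcard : ((box z (R - 1)).card : ℝ) ≤ (box z R).card := by exact_mod_cast Finset.card_le_card (box_mono z (by linarith))
    have hS := hSrc
    simp_rw [← MatrixNorms.sum_norm_sq_eq_re_trace] at hS
    push_cast at hS
    have hm0 : 0 ≤ ∑ j : Fin 2, ∑ k : Fin 2, ‖m j k‖ ^ 2 := by positivity
    have hη2 : 0 ≤ ((eta F n K)⁻¹) ^ 2 := sq_nonneg _
    rw [hr]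
    calc c₀ * (((box z (R - 1)).card : ℝ) * (((eta F n K)⁻¹) ^ 2 * ∑ j : Fin 2, ∑ k : Fin 2, ‖m j k‖ ^ 2))
        ≤ c₀ * (((box z R).card : ℝ) * (((eta F n K)⁻¹) ^ 2 * ∑ j : Fin 2, ∑ k : Fin 2, ‖m j k‖ ^ 2)) := by
          exact mul_le_mul_of_nonneg_left (mul_le_mul_of_nonneg_right hcard (by positivity)) hc₀.le
      _ = c₀ * ((eta F n K)⁻¹) ^ 2 * (((box z R).card : ℝ) * ∑ j : Fin 2, ∑ k : Fin 2, ‖m j k‖ ^ 2) := by ring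
      _ ≤ c₀ * ((eta F n K)⁻¹) ^ 2 * (16 * ((F.P K).d : ℝ) ^ 3 * 2 * R ^ 2 * α ^ 2 *
            ∑ x ∈ box z R, ∑ μ, (if x + unitVec μ ∈ box z R then
              ∑ j : Fin 2, ∑ k : Fin 2, ‖((toL2 F K c₀).symm y ⟨transl c x, μ⟩ - (conjR (V x μ) (φZ (x + unitVec μ)) - φZ x)) j k‖ ^ 2 else 0)) := by
          exact mul_le_mul_of_nonneg_left hS (by positivity)
      _ = _ := by ring

end Summit.QuantumFields.YangMills.Theorems.Prop7BoxLocalPotentialMember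

end
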